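import Summits.SmoothPoincare4.SmoothPoincare4.Theses.ConvexBisection
import Summits.SmoothPoincare4.SmoothPoincare4.Theorems.AcyclicBisectionExists.Negative.OneSided

/-!
# Stub `stub_acyclicRight` of line `modp-braid-orbits` for crux `ConvexBisection.AcyclicBisectionExists`
(item stmt-SmoothPoincare4-10508, route route-SmoothPoincare4-ConvexBisection)

Homology control on ONE half of a Stein bisection suffices over a homotopy 4-sphere: if
`M ≃ₕ S⁴` is covered by two smoothly embedded compact Stein domains `e₁(W₁) ∪ e₂(W₂)` meeting
exactly along the images of their boundaries, with matching pushed-forward complex tangencies on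
the seam, and `W₁` is connected and ℚ-acyclic in positive degrees, then `W₂` is ℚ-acyclic in
positive degrees.

This is the registered stub `stub_acyclicRight` of the checked skeleton
`Cruxes/AcyclicBisectionExists/Lines/modp-braid-orbits.lean` in its lead reshape r1 (the
contact-matching hypothesis, which the composition `AcyclicBisectionExists_of` holds at the call
site, is threaded through so that the data is literally a `Negative.Witness`).  The proof is the
disprover's landed one-sided duality theorem
`Negative.Witness.acyclicRight_of_acyclicLeft_of_homotopyEquiv'` (`Negative/OneSided.lean`):
degrees 1, 2 by the pair sequence of `(M, e₂W₂)` and Lefschetz vanishing on `W₁`, degree 3 by the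
count `H₄(M) ≅ ℚ ↪ H₄(M, e₂W₂) ≅ H₄(W₁, ∂W₁) ≅ H⁰(W₁) ≅ ℚ`, degrees `≥ 4` by an external collar.
-/

noncomputable section

-- the prescribed namespace `Summit.<P>.<Sub>.…` duplicates `SmoothPoincare4` (P = Sub)
set_option linter.dupNamespace false

open scoped Manifold ContDiff Topology ContinuousMap

namespace Summit.SmoothPoincare4.SmoothPoincare4.Theorems.AcyclicBisectionExists.ModpBraidOrbits

open Summit.SmoothPoincare4.SmoothPoincare4.Theorems.AcyclicBisectionExists.Negative

/-- **Stub `stub_acyclicRight` (one-sided acyclicity).** Over `M ≃ₕ S⁴`: for a Stein bisection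
`e₁(W₁) ∪ e₂(W₂) = M` along a common contact seam (smooth embeddings of compact Stein domains
covering `M`, meeting exactly in the images of their boundaries, pushed-forward complex tangencies
equal on the seam) with `W₁` connected and ℚ-acyclic in positive degrees, the second half `W₂` is
ℚ-acyclic in positive degrees.  Repackaging of
`Negative.Witness.acyclicRight_of_acyclicLeft_of_homotopyEquiv'`. [folklore] -/
theorem stub_acyclicRight :
    ∀ (M : Type) [TopologicalSpace M] [T2Space M] [SecondCountableTopology M]
      [ChartedSpace (EuclideanSpace ℝ (Fin 4)) M] [IsManifold (𝓡 4) ∞ M],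
      M ≃ₕ Metric.sphere (0 : EuclideanSpace ℝ (Fin 5)) 1 →
      ∀ (W₁ : Type) [TopologicalSpace W₁] [ChartedSpace (EuclideanHalfSpace 4) W₁]
        [IsManifold (𝓡∂ 4) ∞ W₁] [CompactSpace W₁]
        (W₂ : Type) [TopologicalSpace W₂] [ChartedSpace (EuclideanHalfSpace 4) W₂]
        [IsManifold (𝓡∂ 4) ∞ W₂] [CompactSpace W₂]
        (J₁ : Literature.Geometry.Symplectic.SteinStructure W₁)
        (J₂ : Literature.Geometry.Symplectic.SteinStructure W₂) (e₁ : W₁ → M) (e₂ : W₂ → M),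
        Manifold.IsSmoothEmbedding (𝓡∂ 4) (𝓡 4) ∞ e₁ → Manifold.IsSmoothEmbedding (𝓡∂ 4) (𝓡 4) ∞ e₂ →
        Set.range e₁ ∪ Set.range e₂ = Set.univ →
        Set.range e₁ ∩ Set.range e₂ = e₁ '' (𝓡∂ 4).boundary W₁ →
        Set.range e₁ ∩ Set.range e₂ = e₂ '' (𝓡∂ 4).boundary W₂ →
        (∀ w₁ w₂, e₁ w₁ = e₂ w₂ →
          Submodule.map (mfderiv (𝓡∂ 4) (𝓡 4) e₁ w₁).toLinearMap
              (Literature.Geometry.Symplectic.contactPlane J₁.J w₁) =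
            Submodule.map (mfderiv (𝓡∂ 4) (𝓡 4) e₂ w₂).toLinearMap
              (Literature.Geometry.Symplectic.contactPlane J₂.J w₂)) →
        ConnectedSpace W₁ →
        (∀ k, 0 < k → CategoryTheory.Limits.IsZero
          (Literature.AlgebraicTopology.SingularHomology.singularHomology ℚ ℚ W₁ k)) →
        ∀ k, 0 < k → CategoryTheory.Limits.IsZero
          (Literature.AlgebraicTopology.SingularHomology.singularHomology ℚ ℚ W₂ k) := by
  intro M _ _ _ _ _ e W₁ _ _ _ _ W₂ _ _ _ _ J₁ J₂ e₁ e₂ h₁ h₂ h₃ h₄ h₅ h₆ hconn hac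
  let B : Witness M := ⟨W₁, W₂, J₁, J₂, e₁, e₂, h₁, h₂, h₃, h₄, h₅, h₆⟩
  haveI : Nonempty M := ⟨e.invFun ⟨EuclideanSpace.single 0 1, by simp⟩⟩
  haveI : ConnectedSpace B.W₁ := hconn
  exact B.acyclicRight_of_acyclicLeft_of_homotopyEquiv' e hac

end Summit.SmoothPoincare4.SmoothPoincare4.Theorems.AcyclicBisectionExists.ModpBraidOrbits

end
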